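import Summits.BirchSwinnertonDyer.Rank1Residual.Additive.GoodModelReductionDatum
import Summits.BirchSwinnertonDyer.Rank1Residual.Iwasawa.ResKernelPrimaryVanishing
import Summits.BirchSwinnertonDyer.Rank1Residual.Iwasawa.KummerCountVanishing
import Summits.BirchSwinnertonDyer.Rank1Residual.Iwasawa.PrimeOrderLineCocycleCount
import Summits.BirchSwinnertonDyer.Rank1Residual.Iwasawa.PrimeTorsionLineDecomposition
import Summits.BirchSwinnertonDyer.Rank1Residual.Iwasawa.LocalTowerKernelZeroOfResKer
import Literature.NumberTheory.EllipticCurves.SelmerCorankControlRatOrdinaryProofs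
import Literature.NumberTheory.EllipticCurves.CyclotomicLineWeilPairingProofs
import HarnessLib

/-!
# T-T3B END: the `v = p` local tower kernel at level `0` VANISHES for a GOOD MODEL with an ordinary
# point whose quotient `E[p]/C[p]` is moved inside `(ker κ)_v` — `W.localTowerKerPrimary κ ℚ_v 0 = ⊥`
# (team n1011, row T-T3B = p06's T-T3CTL F3 = r2's T3b; seat p12 GEN 8; file F5)

HONEST FRAMING (cell `b2b-bsdres`, run/shared/lean/b2b/bsd-rank1-residual/, verbatim in every
file): the goal of the cell is to DELETE the COMBINATION-SHAPED residual classes of the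
Birch–Swinnerton-Dyer formula for ALL analytic-rank `≤ 1` elliptic curves over `ℚ` — "full BSD
formula for every rank `≤ 1` curve in class `C`" assembled STRICTLY from published theorems — so
that the rank-`≤ 1` remainder becomes exactly the CONSTRUCTION-SHAPED classes, which are TYPED
(missing-input `Prop`s), NOT attempted. This is not "finishing BSD". Team n1011 (N10/N11; row
T-T3B, skeleton `cells/n1011/skel/T-T3B.md`): research routes on CONSTRUCTION-SHAPED classes
(ROUTE 2, the V20X / (G-ord) receivers and their congruent partners); prove what is provable now; no
claim beyond stated classes; census output = EVIDENCE, never a Literature fact; RESIDUAL-MAP marks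
UNCHANGED; nothing is booked by this file. TOOL THEOREMS ONLY: no definition, no named fact,
nothing cited enters as a hypothesis. It closes no class by itself: it produces the `v ∣ p` binder
`hp0 : W.localTowerKerPrimary κ (v.adicCompletion ℚ) 0 = ⊥` of p06's T-T3CTL ENDs
(`Iwasawa/SelmerInftyTrivialOfLevelZero`, Greenberg LNM 1716 Prop. 3.8 at level `0`).

## What

For `E = W/ℚ` elliptic, `p` prime, `v ∋ p`, a GOOD MODEL `W₀ = C • E ⊗ K̄_v` over the valuation ring
of the spectral valuation of `K̄_v` (p05 T-ROL-G F-A1/F-A2 currency: `hW₀`, `hΔ`, the reduction map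
`red = red_{W₀} ∘ Φ_C` on `E(K̄_v)` pinned by `hred`) with an ORDINARY point (`hord`), ANY
`ℤ_p`-extension `κ` of `ℚ`, and an element of `(ker κ)_v = Gal(K̄_v / ℚ_v ℚ_∞)` MOVING `E[p]/C[p]`
(`hmove`; on every additive potentially good ordinary row such an element exists in the inertia
group: the quotient character `ω^i`, `i = (p−1)·v_p(Δ)/12 ≢ 0 (mod p−1)`, is non-trivial on the
inertia above `ℚ_{p,∞}` — the row's file F6 discharges it from `¬ W.HasGoodReductionAt v`), and
the four arithmetic inputs of the row's file F4 (`Additive/GoodModelKernelRationalPoints`, p07 GEN 9;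
displayed here as hypotheses `hdiv₁`, `htor`, `hTfin`, `hu` with FROZEN shapes):

  `GoodModelLine.localTowerKerPrimary_zero_eq_bot_of_goodModel : W.localTowerKerPrimary κ (v.adicCompletion ℚ) 0 = ⊥`,

i.e. `ker (H¹(ℚ_v, E(K̄_v)) → H¹(ℚ_v ℚ_∞, E(K̄_v)))[p^∞] = 0` — Greenberg's Lemma 3.4 at level `0`
(LNM 1716 p. 89: `#ker(r_v) = #Ẽ(𝔽_p)(p)²` in the good ordinary case) with BOTH anomalous factors
equal to `1` because the étale quotient carries a RAMIFIED character. Assembly, no new idea: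
(S1) dévissage `A₁ = ker red ≤ A = E(K̄_v)` (`Γ_{ℚ_v}`-stable: F-A2 `red_smul_eq_zero_iff`);
(S2)+(S3) F1 `ResKernelPrimary.exists_kerValued_cocycle_of_pow_smul_eq_zero` with its `hnp`
("`D[p]^N = 0`") from F5a `PrimeTorsionLine.mem_of_sub_mem_of_moves`; (S4) F3
`PrimeOrderLine.exists_finset_cocycle_reps` (Tate EPC + local duality (2,0), `#(ℤ_v/p) = p`
(`natCard_adicCompletionIntegers_quot_span_eq`), with `hχ` = F5a `exists_lineScalar_quotScalar` +
the tree's Weil scalar lemma `localPoints_exists_isPrimitiveRoot_smul_eq_pow`) fed into F2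
`KummerCount.oneCocycleClass_eq_zero_of_kerValued`; (S5) F5b
`localTowerKerPrimary_zero_eq_bot_of_forall_subgroupResKer_eq_zero`. NO Coates–Greenberg record,
no Delbourgo, no image hypothesis, no `hEP` binder.

References: [GreenbergLNM1716] R. Greenberg, LNM 1716 (1999), §2 pp. 70–73, §3 Lemma 3.4 (p. 89),
Prop. 3.8 (p. 95); [MilneADT2006] J. S. Milne, *ADT*, I Thm. 2.8, Cor. 2.3; [SilvermanAEC2009]
J. H. Silverman, *AEC*, III.6.4(b), III.8.1, VII.2.1–2.2; cells/n1011/skel/T-T3B.md; r2 ROUTE-2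
§II.28.3 (c1), §II.30.4; p06 skel/T-T3CTL.md §1 F3.
-/

noncomputable section

open scoped Classical NNReal

open WeierstrassCurve

universe u

namespace Summit.BirchSwinnertonDyer.Rank1Residual.Additive.GoodModelLine

open NumberField IsDedekindDomain Field IsDedekindDomain.HeightOneSpectrum
  Literature.NumberTheory.GaloisRepresentations
  Literature.NumberTheory.EllipticCurves
  Literature.NumberTheory.EllipticCurves.ResKernel
  Literature.NumberTheory.EllipticCurves.GreenbergSelmer
  Summit.BirchSwinnertonDyer.Rank1Residual.X2.GreenbergVatsalReductionDatum
  Summit.BirchSwinnertonDyer.Rank1Residual.X2.GreenbergVatsalTateDatumCofree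
  Summit.BirchSwinnertonDyer.Rank1Residual.Iwasawa

/-! ## §1 `#(ℤ_v / p) = p` at the place of `ℚ` above `p` -/

section Rat

variable {p : ℕ} [hp : Fact p.Prime] {v : HeightOneSpectrum (𝓞 ℚ)}

/-- **`#(𝓞_v / p𝓞_v) = p` for the place `v` of `ℚ` above `p`**: `p` is a uniformizer of
`ℤ_v ≅ ℤ_p` (`irreducible_natCast_adicCompletionIntegers_rat`), so `p𝓞_v` is the maximal ideal and
the quotient is the residue field, of cardinality `p` (`natCard_residueField_adicCompletionIntegers`).
This is the factor `(𝒪_F : p𝒪_F)` of Tate's local Euler–Poincaré characteristic for `F = ℚ_p` and a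
module of order `p`. [folklore] -/
theorem natCard_adicCompletionIntegers_quot_span_eq (hpv : (p : 𝓞 ℚ) ∈ v.asIdeal) :
    Nat.card (v.adicCompletionIntegers ℚ ⧸
      Ideal.span {((p : ℕ) : v.adicCompletionIntegers ℚ)}) = p := by
  have hirr := irreducible_natCast_adicCompletionIntegers_rat (p := p) hpv
  have hmax : IsLocalRing.maximalIdeal (v.adicCompletionIntegers ℚ) =
      Ideal.span {((p : ℕ) : v.adicCompletionIntegers ℚ)} :=
    (IsDiscreteValuationRing.irreducible_iff_uniformizer _).mp hirr
  rw [← hmax]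
  change Nat.card (IsLocalRing.ResidueField (v.adicCompletionIntegers ℚ)) = p
  rw [natCard_residueField_adicCompletionIntegers v,
    Rat.HeightOneSpectrum.primesEquiv_eq_of_natCast_mem v hp.out hpv]

end Rat

/-! ## §2 The END -/

section Local

open Literature.NumberTheory.EllipticCurves.EmertonPollackWeston2006

variable (W : WeierstrassCurve ℚ) [W.IsElliptic] (p : ℕ) [hp : Fact p.Prime]
  {v : HeightOneSpectrum (𝓞 ℚ)}
  {C : VariableChange (AlgebraicClosure (v.adicCompletion ℚ))}
  {W₀ : WeierstrassCurve (specVal v).integer}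
  (hW₀ : C • (W.baseChange (v.adicCompletion ℚ)).baseChange (AlgebraicClosure (v.adicCompletion ℚ)) =
    W₀.baseChange (AlgebraicClosure (v.adicCompletion ℚ)))
  (hΔ : IsUnit W₀.Δ)
  (red : localPoints W (v.adicCompletion ℚ) →+
    (W₀.map (IsLocalRing.residue (specVal v).integer)).toAffine.Point)
  (hred : ∀ P, red P = goodReductionHom W₀ (Valuation.integer.integers (specVal v)) hΔ
    (Affine.Point.congrEquiv hW₀ (VariableChange.pointEquiv _ C
      (Affine.Point.congrEquiv (baseChange_baseChange_adicCompletion W v).symm P))))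

set_option maxHeartbeats 800000 in
include hred in
/-- **T-T3B END — `𝒦_{v,0}[p^∞] = 0` at `v ∋ p` for a good model with an ordinary point and a
moving element in `(ker κ)_v`.** Hypotheses: the good-model data of p05's F-A2 (`hW₀`, `hΔ`, `red`,
`hred`), `hpv`, the ordinary point `hord` (F-A2's form), ANY `ℤ_p`-extension `κ` of `ℚ`, the four
inputs of the row's file F4 on `A₁ = ker red` — `hdiv₁` (`A₁` is `p`-divisible), `htor` (every point
has a positive multiple in `A₁`), `hTfin` (`A₁^{Γ_v}[p^∞]` is finite), `hu` (a `Γ_v`-fixed `u ∈ A₁`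
outside `p A₁^{Γ_v} + A₁^{Γ_v}[p^∞]`) — and `hmove`: some `σ ∈ (ker κ)_v` and `P ∈ E[p]` with
`red (σP − P) ≠ Õ`. Conclusion: `W.localTowerKerPrimary κ (v.adicCompletion ℚ) 0 = ⊥`. Proof =
F5b ∘ (F1 with `hnp` from F5a `mem_of_sub_mem_of_moves`) ∘ (F2 with the count of F3 — `C[p]` has
order `p` by `exists_generator_torsionBy_ker_goodReductionHom`, `#E[p] = p²` by
`card_torsionBy_eq_sq`, `hχ` by F5a `exists_lineScalar_quotScalar` and the Weil scalar lemma
`localPoints_exists_isPrimitiveRoot_smul_eq_pow`, `#(ℤ_v/p) = p`). Greenberg, LNM 1716, Lemma 3.4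
with both anomalous factors `= 1`. [cite: GreenbergLNM1716, §3 Lemma 3.4 (p. 89) and Prop. 3.8 (p. 95)]
[cite: MilneADT2006, Ch. I §2, Thm. 2.8 (p. 31) and Cor. 2.3] -/
theorem localTowerKerPrimary_zero_eq_bot_of_goodModel (hpv : ((p : ℕ) : 𝓞 ℚ) ∈ v.asIdeal)
    (hord : ∃ P : (W₀.baseChange (AlgebraicClosure (v.adicCompletion ℚ))).toAffine.Point,
      (p : ℤ) • P = 0 ∧ goodReductionHom W₀ (Valuation.integer.integers (specVal v)) hΔ P ≠ 0)
    (κ : ZpExtension ℚ p)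
    (hdiv₁ : ∀ P : localPoints W (v.adicCompletion ℚ), red P = 0 →
      ∃ Q : localPoints W (v.adicCompletion ℚ), red Q = 0 ∧ p • Q = P)
    (htor : ∀ P : localPoints W (v.adicCompletion ℚ), ∃ n : ℕ, 0 < n ∧ red (n • P) = 0)
    (hTfin : Set.Finite {P : localPoints W (v.adicCompletion ℚ) | red P = 0 ∧
      (∀ σ : absoluteGaloisGroup (v.adicCompletion ℚ), σ • P = P) ∧ ∃ k : ℕ, p ^ k • P = 0})
    (hu : ∃ u : localPoints W (v.adicCompletion ℚ), red u = 0 ∧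
      (∀ σ : absoluteGaloisGroup (v.adicCompletion ℚ), σ • u = u) ∧
      ∀ c t : localPoints W (v.adicCompletion ℚ), red c = 0 →
        (∀ σ : absoluteGaloisGroup (v.adicCompletion ℚ), σ • c = c) → red t = 0 →
        (∀ σ : absoluteGaloisGroup (v.adicCompletion ℚ), σ • t = t) → (∃ k : ℕ, p ^ k • t = 0) →
          u ≠ p • c + t)
    (hmove : ∃ σ ∈ localSubgroup κ.kerSubgroup (v.adicCompletion ℚ),
      ∃ P : localPoints W (v.adicCompletion ℚ), p • P = 0 ∧ red (σ • P - P) ≠ 0) :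
    W.localTowerKerPrimary κ (v.adicCompletion ℚ) 0 = ⊥ := by
  -- notation and instances
  haveI := charP_residueField_specVal p hpv
  have hcont : ∀ a : localPoints W (v.adicCompletion ℚ), Continuous fun g : absoluteGaloisGroup (v.adicCompletion ℚ) ↦ g • a := continuous_smul_localPoints W (v.adicCompletion ℚ)
  -- `A₁ = ker red` is `absoluteGaloisGroup (v.adicCompletion ℚ)`-stable
  have hstab : ∀ (σ : absoluteGaloisGroup (v.adicCompletion ℚ)) (P : localPoints W (v.adicCompletion ℚ)), red P = 0 → red (σ • P) = 0 :=
    fun σ P h ↦ (red_smul_eq_zero_iff W hW₀ hΔ red hred σ P).mpr h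
  have hA₁ : ∀ (σ : absoluteGaloisGroup (v.adicCompletion ℚ)) (a : localPoints W (v.adicCompletion ℚ)), a ∈ red.ker → σ • a ∈ red.ker :=
    fun σ a ha ↦ (AddMonoidHom.mem_ker).mpr (hstab σ a ((AddMonoidHom.mem_ker).mp ha))
  have hdiv : ∀ a : localPoints W (v.adicCompletion ℚ), ∃ b : localPoints W (v.adicCompletion ℚ), p • b = a := fun a ↦
    nsmul_surjective_of_isAlgClosed (V := W.baseChange (AlgebraicClosure (v.adicCompletion ℚ)))
      hp.out.ne_zero a
  have hdiv₁' : ∀ a ∈ red.ker, ∃ b ∈ red.ker, p • b = a := fun a ha ↦ by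
    obtain ⟨b, hb, hpb⟩ := hdiv₁ a ((AddMonoidHom.mem_ker).mp ha)
    exact ⟨b, (AddMonoidHom.mem_ker).mpr hb, hpb⟩
  have htor' : ∀ a : localPoints W (v.adicCompletion ℚ), ∃ n : ℕ, 0 < n ∧ n • a ∈ red.ker := fun a ↦ by
    obtain ⟨n, hn, hna⟩ := htor a
    exact ⟨n, hn, (AddMonoidHom.mem_ker).mpr hna⟩
  -- a topological generator of `absoluteGaloisGroup (v.adicCompletion ℚ) / localSubgroup κ.kerSubgroup (v.adicCompletion ℚ)`
  obtain ⟨g, -, hgen⟩ := ZpExtension.exists_mem_localSubgroup_generate κ (v.adicCompletion ℚ) 0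
  have hmem0 : ∀ σ : absoluteGaloisGroup (v.adicCompletion ℚ), σ ∈ localSubgroup (κ.layerSubgroup 0) (v.adicCompletion ℚ) := fun σ ↦ by
    rw [mem_localSubgroup_iff, ZpExtension.layerSubgroup_zero]
    exact Subgroup.mem_top _
  have hgen' : ∀ U : Subgroup (absoluteGaloisGroup (v.adicCompletion ℚ)),
      IsOpen (U : Set (absoluteGaloisGroup (v.adicCompletion ℚ))) →
        localSubgroup κ.kerSubgroup (v.adicCompletion ℚ) ≤ U → g ∈ U → U = ⊤ :=
    fun U hU hHiU hgU ↦ eq_top_iff.mpr fun σ _ ↦ hgen U hU hHiU hgU (hmem0 σ)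
  -- the transport `Φ : E(K̄_v) ≃ W₀(K̄_v)` and the reduction map
  let Φ₁ : localPoints W (v.adicCompletion ℚ) ≃+ ((W.baseChange (v.adicCompletion ℚ)).baseChange
      (AlgebraicClosure (v.adicCompletion ℚ))).toAffine.Point :=
    Affine.Point.congrEquiv (baseChange_baseChange_adicCompletion W v).symm
  let Φ : localPoints W (v.adicCompletion ℚ) ≃+ (W₀.baseChange (AlgebraicClosure (v.adicCompletion ℚ))).toAffine.Point :=
    (Φ₁.trans (VariableChange.pointEquiv _ C)).trans (Affine.Point.congrEquiv hW₀)
  have hredΦ : ∀ P, red P = goodReductionHom W₀ (Valuation.integer.integers (specVal v)) hΔ (Φ P) :=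
    fun P ↦ hred P
  -- `C[p] = ker red ∩ E[p]` is cyclic of order `p` on a generator `P₁`
  obtain ⟨P₀, hP₀0, hordP₀, hgenP₀⟩ :
      ∃ P₀ : (W₀.baseChange (AlgebraicClosure (v.adicCompletion ℚ))).toAffine.Point,
        goodReductionHom W₀ (Valuation.integer.integers (specVal v)) hΔ P₀ = 0 ∧
        addOrderOf P₀ = p ^ 1 ∧
        ∀ P : (W₀.baseChange (AlgebraicClosure (v.adicCompletion ℚ))).toAffine.Point,
          goodReductionHom W₀ (Valuation.integer.integers (specVal v)) hΔ P = 0 →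
            ((p ^ 1 : ℕ) : ℤ) • P = 0 → ∃ c : ℕ, P = c • P₀ := by
    haveI : CharZero (AlgebraicClosure (v.adicCompletion ℚ)) := charZero_of_injective_algebraMap
      (algebraMap ℚ (AlgebraicClosure (v.adicCompletion ℚ))).injective
    exact exists_generator_torsionBy_ker_goodReductionHom
      (O := (specVal v).valuationSubring) (Valuation.integer.integers (specVal v)) hΔ hord 1
  rw [pow_one] at hordP₀
  set P₁ : localPoints W (v.adicCompletion ℚ) := Φ.symm P₀ with hP₁def
  have hΦP₁ : Φ P₁ = P₀ := by rw [hP₁def, AddEquiv.apply_symm_apply]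
  have hP₁K : P₁ ∈ red.ker := by
    rw [AddMonoidHom.mem_ker, hredΦ, hΦP₁]; exact hP₀0
  have hP₁ord : addOrderOf P₁ = p := by
    rw [hP₁def, AddEquiv.addOrderOf_eq]; exact hordP₀
  have hP₁p : p • P₁ = 0 := by rw [← hP₁ord]; exact addOrderOf_nsmul_eq_zero P₁
  have hK : ∀ P : localPoints W (v.adicCompletion ℚ), P ∈ red.ker → p • P = 0 → ∃ c : ℕ, P = c • P₁ := by
    intro P hPK hPp
    have h1 : goodReductionHom W₀ (Valuation.integer.integers (specVal v)) hΔ (Φ P) = 0 := by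
      rw [← hredΦ]; exact (AddMonoidHom.mem_ker).mp hPK
    have h2 : ((p ^ 1 : ℕ) : ℤ) • Φ P = 0 := by
      rw [natCast_zsmul, pow_one, ← map_nsmul, hPp, map_zero]
    obtain ⟨c, hc⟩ := hgenP₀ (Φ P) h1 h2
    refine ⟨c, Φ.injective ?_⟩
    rw [hc, map_nsmul, hΦP₁]
  -- `#E[p] = p²`
  have hcardA : Nat.card {Q : localPoints W (v.adicCompletion ℚ) // p • Q = 0} = p ^ 2 := by
    have h : Nat.card (AddSubgroup.torsionBy
        (W.baseChange (AlgebraicClosure (v.adicCompletion ℚ))).toAffine.Point (p : ℤ)) = p ^ 2 := by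
      have hn : ((p : ℕ) : AlgebraicClosure (v.adicCompletion ℚ)) ≠ 0 := by
        haveI : CharZero (AlgebraicClosure (v.adicCompletion ℚ)) := charZero_of_injective_algebraMap
          (algebraMap ℚ (AlgebraicClosure (v.adicCompletion ℚ))).injective
        exact_mod_cast hp.out.ne_zero
      exact card_torsionBy_eq_sq (E := W.baseChange (AlgebraicClosure (v.adicCompletion ℚ))) hn
    rw [← h]
    exact Nat.card_congr
      { toFun := fun x ↦ ⟨(show (W.baseChange (AlgebraicClosure (v.adicCompletion ℚ))).toAffine.Point
            from x.1), (Submodule.mem_torsionBy_iff (R := ℤ) _ _).mpr (by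
          rw [natCast_zsmul]; exact x.2)⟩
        invFun := fun x ↦ ⟨(show localPoints W (v.adicCompletion ℚ) from x.1), by
          have hx := (Submodule.mem_torsionBy_iff (R := ℤ) _ _).mp x.2
          rw [natCast_zsmul] at hx
          exact hx⟩
        left_inv := fun _ ↦ rfl
        right_inv := fun _ ↦ rfl }
  -- the moving element, as an endomorphism
  obtain ⟨σ, hσN, Pm, hPm, hσPm⟩ := hmove
  let σ' : localPoints W (v.adicCompletion ℚ) →+ localPoints W (v.adicCompletion ℚ) :=
    DistribSMul.toAddMonoidHom (localPoints W (v.adicCompletion ℚ)) σ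
  have hσ' : ∀ a : localPoints W (v.adicCompletion ℚ), σ' a = σ • a := fun _ ↦ rfl
  have hσ'K : ∀ P ∈ red.ker, σ' P ∈ red.ker := fun P hP ↦ hA₁ σ P hP
  have hσ'inj : Function.Injective σ' := fun a b h ↦ MulAction.injective σ (by
    change σ • a = σ • b
    rw [← hσ', ← hσ']; exact h)
  have hmove' : ∃ P : localPoints W (v.adicCompletion ℚ), p • P = 0 ∧ σ' P - P ∉ red.ker :=
    ⟨Pm, hPm, fun h ↦ hσPm ((AddMonoidHom.mem_ker).mp h)⟩
  -- (S2) no `p`-torsion in `(localPoints W (v.adicCompletion ℚ)/A₁)^localSubgroup κ.kerSubgroup (v.adicCompletion ℚ)`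
  have hnp : ∀ a : localPoints W (v.adicCompletion ℚ), (∀ n ∈ localSubgroup κ.kerSubgroup (v.adicCompletion ℚ), n • a - a ∈ red.ker) → p • a ∈ red.ker → a ∈ red.ker := by
    intro a haN hpa
    obtain ⟨t, hpt, hat⟩ := ResKernelPrimary.exists_psmul_eq_zero_sub_mem p red.ker hdiv₁' hpa
    have hσt : σ' t - t ∈ red.ker := by
      have h1 : σ • a - a ∈ red.ker := haN σ hσN
      have h2 : σ • (a - t) - (a - t) ∈ red.ker := red.ker.sub_mem (hA₁ σ _ hat) hat
      have h3 : σ' t - t = (σ • a - a) - (σ • (a - t) - (a - t)) := by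
        rw [hσ', smul_sub]; abel
      rw [h3]; exact red.ker.sub_mem h1 h2
    have ht : t ∈ red.ker :=
      PrimeTorsionLine.mem_of_sub_mem_of_moves red.ker hP₁K hP₁ord hcardA σ' hσ'K hmove' hpt hσt
    have : a = (a - t) + t := by abel
    rw [this]; exact red.ker.add_mem hat ht
  -- (S4) the count: `C[p]` as a subgroup of prime order with a non-cyclotomic character
  let Cp : AddSubgroup (localPoints W (v.adicCompletion ℚ)) :=
    { carrier := {P | P ∈ red.ker ∧ p • P = 0}
      zero_mem' := ⟨red.ker.zero_mem, smul_zero _⟩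
      add_mem' := fun {a b} ha hb ↦ ⟨red.ker.add_mem ha.1 hb.1, by rw [smul_add, ha.2, hb.2, add_zero]⟩
      neg_mem' := fun {a} ha ↦ ⟨red.ker.neg_mem ha.1, by rw [smul_neg, ha.2, neg_zero]⟩ }
  have hmemCp : ∀ P : localPoints W (v.adicCompletion ℚ), P ∈ Cp ↔ P ∈ red.ker ∧ p • P = 0 := fun _ ↦ Iff.rfl
  have hCpstab : ∀ (τ : absoluteGaloisGroup (v.adicCompletion ℚ)) (a : localPoints W (v.adicCompletion ℚ)), a ∈ Cp → τ • a ∈ Cp := fun τ a ha ↦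
    ⟨hA₁ τ a ha.1, by rw [smul_comm, ha.2, smul_zero]⟩
  have hpCp : ∀ a ∈ Cp, p • a = 0 := fun a ha ↦ ha.2
  have hCpeq : Cp = AddSubgroup.zmultiples P₁ := by
    refine le_antisymm (fun Q hQ ↦ ?_) (AddSubgroup.zmultiples_le.mpr ⟨hP₁K, hP₁p⟩)
    obtain ⟨c, rfl⟩ := hK Q hQ.1 hQ.2
    exact AddSubgroup.mem_zmultiples_iff.mpr ⟨c, natCast_zsmul P₁ c⟩
  have hcardCp : Nat.card Cp = p := by rw [hCpeq, Nat.card_zmultiples, hP₁ord]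
  -- the scalars and the Weil pairing: `σ` acts on `C[p]` by `a`, on `μ_p` by `c' a`, `a ≢ c' a`
  obtain ⟨a, c', hline, hquot, -, -, hac⟩ := PrimeTorsionLine.exists_lineScalar_quotScalar red.ker
    hP₁K hP₁ord hK hcardA σ' hσ'inj hσ'K hmove'
  have hP₁ord1 : addOrderOf P₁ = p ^ 1 := by rw [pow_one]; exact hP₁ord
  obtain ⟨ζ, hζ, hσζ⟩ := @WeierstrassCurve.localPoints_exists_isPrimitiveRoot_smul_eq_pow ℚ _ W _
    (v.adicCompletion ℚ) _ _
    (charZero_of_injective_algebraMap (algebraMap ℚ (v.adicCompletion ℚ)).injective) p _ 1 P₁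
    hP₁ord1 ({σ} : Set (absoluteGaloisGroup (v.adicCompletion ℚ))) (fun _ ↦ a) (fun _ ↦ c')
    (fun τ hτ ↦ by
      rw [Set.mem_singleton_iff.mp hτ, ← hσ']
      exact hline P₁ hP₁K hP₁p)
    (fun τ hτ Q hQ ↦ by
      rw [Set.mem_singleton_iff.mp hτ, ← hσ']
      exact hquot Q (by rwa [natCast_zsmul, pow_one] at hQ))
  have hσζ' : σ • ζ = ζ ^ (c' * a) := hσζ σ (Set.mem_singleton σ)
  rw [pow_one] at hζ
  have hσμ : ∀ ξ : AlgebraicClosure (v.adicCompletion ℚ), ξ ^ p = 1 → σ • ξ = ξ ^ (c' * a) := by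
    intro ξ hξ
    obtain ⟨i, -, rfl⟩ := hζ.eq_pow_of_pow_eq_one hξ
    rw [smul_pow', hσζ', ← pow_mul, ← pow_mul, Nat.mul_comm]
  have hχ : ∃ (τ : absoluteGaloisGroup (v.adicCompletion ℚ)) (a₀ b₀ : ℕ), (∀ c ∈ Cp, τ • c = a₀ • c) ∧
      (∀ ξ : AlgebraicClosure (v.adicCompletion ℚ), ξ ^ p = 1 → τ • ξ = ξ ^ b₀) ∧
      ¬ a₀ ≡ b₀ [MOD p] :=
    ⟨σ, a, c' * a, fun c hc ↦ by rw [← hσ']; exact hline c hc.1 hc.2, hσμ, hac⟩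
  obtain ⟨S, hS, hrep⟩ := PrimeOrderLine.exists_finset_cocycle_reps ℚ v hcont p Cp hCpstab hpCp
    hcardCp hχ
  -- rewrite the bound `#(ℤ_v/p) · #C[p]^absoluteGaloisGroup (v.adicCompletion ℚ) = p · #A₁^absoluteGaloisGroup (v.adicCompletion ℚ)[p]`
  have hS' : S.card ≤ p * Nat.card {x : localPoints W (v.adicCompletion ℚ) // x ∈ red.ker ∧ (∀ τ : absoluteGaloisGroup (v.adicCompletion ℚ), τ • x = x) ∧ p • x = 0} := by
    rw [natCard_adicCompletionIntegers_quot_span_eq (p := p) hpv] at hS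
    refine hS.trans (le_of_eq ?_)
    congr 1
    exact Nat.card_congr
      { toFun := fun x ↦ ⟨x.1, x.2.1.1, x.2.2, x.2.1.2⟩
        invFun := fun x ↦ ⟨x.1, ⟨x.2.1, x.2.2.2⟩, x.2.2.1⟩
        left_inv := fun _ ↦ rfl
        right_inv := fun _ ↦ rfl }
  have hrep' : ∀ ψ : contOneCocycles (discreteTopRep (absoluteGaloisGroup (v.adicCompletion ℚ))
      (localPoints W (v.adicCompletion ℚ))), (∀ g', ψ.1 g' ∈ red.ker) →
      (∀ g', p • ψ.1 g' = 0) → ∃ ψ₀ ∈ S, ∃ t ∈ red.ker, p • t = 0 ∧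
        ∀ g', ψ.1 g' - ψ₀.1 g' = g' • t - t := by
    intro ψ h1 h2
    obtain ⟨ψ₀, hψ₀, t, ht, h⟩ := hrep ψ (fun g' ↦ ⟨h1 g', h2 g'⟩)
    exact ⟨ψ₀, hψ₀, t, ht.1, ht.2, h⟩
  -- the F4 inputs in `ker`-form
  have hTfin' : Set.Finite {x : localPoints W (v.adicCompletion ℚ) | x ∈ red.ker ∧ (∀ τ : absoluteGaloisGroup (v.adicCompletion ℚ), τ • x = x) ∧ ∃ k : ℕ, p ^ k • x = 0} := by
    refine hTfin.subset fun x hx ↦ ?_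
    exact ⟨(AddMonoidHom.mem_ker).mp hx.1, hx.2.1, hx.2.2⟩
  obtain ⟨u, hu0, huG, hu⟩ := hu
  have hu₁ : u ∈ red.ker := (AddMonoidHom.mem_ker).mpr hu0
  have hu' : ∀ c t : localPoints W (v.adicCompletion ℚ), c ∈ red.ker → (∀ τ : absoluteGaloisGroup (v.adicCompletion ℚ), τ • c = c) → t ∈ red.ker → (∀ τ : absoluteGaloisGroup (v.adicCompletion ℚ), τ • t = t) →
      (∃ k : ℕ, p ^ k • t = 0) → u ≠ p • c + t := fun c t hc hcG ht htG htk ↦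
    hu c t ((AddMonoidHom.mem_ker).mp hc) hcG ((AddMonoidHom.mem_ker).mp ht) htG htk
  -- (S5) assemble
  refine W.localTowerKerPrimary_zero_eq_bot_of_forall_subgroupResKer_eq_zero κ (v.adicCompletion ℚ)
    fun x hx k hk ↦ ?_
  obtain ⟨m, ψ, hψx, hψm, hψ₁⟩ := ResKernelPrimary.exists_kerValued_cocycle_of_pow_smul_eq_zero
    (localSubgroup κ.kerSubgroup (v.adicCompletion ℚ)) g
    hgen' hcont p red.ker hA₁ hdiv hdiv₁' htor' hnp hx hk
  rw [← hψx]
  exact (KummerCount.oneCocycleClass_eq_zero_of_kerValued hcont p red.ker hA₁ hdiv₁' hTfin' hu₁ huG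
    hu' S hS' hrep' ψ hψ₁ hψm).2

end Local

end Summit.BirchSwinnertonDyer.Rank1Residual.Additive.GoodModelLine

end
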